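import Summits.ValiantsHypothesis.ValiantsHypothesis.Theorems.LacunarySymmetroidMatrixDescartesDoorA26WallBubblingBubblingNormalisation
import Summits.ValiantsHypothesis.ValiantsHypothesis.Theorems.LacunarySymmetroidMatrixDescartesTailGraft
import Summits.ValiantsHypothesis.ValiantsHypothesis.Theorems.LacunarySymmetroidMatrixDescartesDoorA26NullEndPerturbation

/-!
# Wall bubbling for `DoorA26` — obligation (R), END profiles read positively, part 1: un-nulling a letter of an exponential pencil (asymptotics)

HONEST FRAMING.  Helper lemmas for the line `Cruxes/DoorA26/Lines/wall_bubbling.lean` (crux stmt-ValiantsHypothesis-19979 `DoorA26`; OPEN, typed,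
never asserted), W2 seat val-sym-door-p1 g16; obligation (R).  Def-free; nothing here bears on `DoorA26`, `MatrixDescartes` (stmt-ValiantsHypothesis-18050)
or `VP ≠ VNP`; registers unchanged.  Real-exponent («log-time») currency: pencils `P(t) = Σ_l e^{δ_l t} S_l` with `S_l` symmetric `2×2`.

CONTENT.  Replacing one letter `S_i` by `S_i + η·1`: evaluation, determinant as a quadratic in `η`, continuity (symmetry of the updated letters is
`NullEnd.isSymm_update`, and `tr ≠ 0` for a null non-zero symmetric letter is `TailGraft.trace_ne_zero_of_det_eq_zero` — both already in the tree); and the leading terms `det P(t) e^{−2δ₅ t} → det S₅` (`t → +∞`), `det P(t) e^{−2δ₀ t} → det S₀` (`t → −∞`) for strictly increasing `δ`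
(the sign-bookkeeping helpers are `NullEnd.neg_of_sign_transfer` / `NullEnd.neg_of_sign_chain`).  Used by part 2 (`…WallBubblingNullEndTwenty.lean`: one more alternation per null end letter ⇒ membership in `Bubbling.TwentyLocus`).
The integer-exponent twins (refutation side) are `…DoorA26NullEndPerturbation.lean` / `…NullEndExtension.lean`.

[folklore] continuity + leading terms of exponential sums; [this work] the wiring.
-/

-- `Summit.ValiantsHypothesis.ValiantsHypothesis.…` repeats a component by the D-0017 layout
-- (single-conjunct summit), which the `dupNamespace` linter flags; the name is mandated.
set_option linter.dupNamespace false

namespace Summit.ValiantsHypothesis.ValiantsHypothesis.Theorems.LacunarySymmetroidMatrixDescartes.WallBubbling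

open Finset Filter Topology
open Bubbling (polar polar_self det_sum_smul_fin_two)

/-! ## §1 Un-nulling one letter of an exponential pencil -/

/-- The exponential pencil with letter `i` replaced by `S i + η·1`, at time `t`. [folklore] -/
theorem expPencil_update_eval (δ : Fin 6 → ℝ) (S : Fin 6 → Matrix (Fin 2) (Fin 2) ℝ) (i : Fin 6) (η t : ℝ) :
    (∑ l, Real.exp (δ l * t) • Function.update S i (S i + η • (1 : Matrix (Fin 2) (Fin 2) ℝ)) l)
      = (∑ l, Real.exp (δ l * t) • S l) + (η * Real.exp (δ i * t)) • (1 : Matrix (Fin 2) (Fin 2) ℝ) := by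
  have : ∀ l, Real.exp (δ l * t) • Function.update S i (S i + η • (1 : Matrix (Fin 2) (Fin 2) ℝ)) l
      = Real.exp (δ l * t) • S l + (if l = i then (η * Real.exp (δ i * t)) • (1 : Matrix (Fin 2) (Fin 2) ℝ) else 0) := by
    intro l
    by_cases h : l = i
    · subst h
      simp only [Function.update_self, smul_add, if_true, smul_smul]
      ring_nf
    · simp only [Function.update_of_ne h, if_neg h, add_zero]
  simp_rw [this, Finset.sum_add_distrib, Finset.sum_ite_eq' Finset.univ i, if_pos (Finset.mem_univ _)]

/-- Determinant of the updated exponential pencil as a quadratic in `η`. [folklore] -/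
theorem det_expPencil_update_eq (δ : Fin 6 → ℝ) (S : Fin 6 → Matrix (Fin 2) (Fin 2) ℝ) (i : Fin 6) (η t : ℝ) :
    (∑ l, Real.exp (δ l * t) • Function.update S i (S i + η • (1 : Matrix (Fin 2) (Fin 2) ℝ)) l).det
      = (∑ l, Real.exp (δ l * t) • S l).det + (η * Real.exp (δ i * t)) * (∑ l, Real.exp (δ l * t) • S l).trace
        + (η * Real.exp (δ i * t)) ^ 2 := by
  rw [expPencil_update_eval, LacunarySymmetroidMatrixDescartes.TailGraft.det_add_smul_one_two]

/-- Continuity in `η` of the updated determinant at a fixed time. [folklore] -/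
theorem continuous_det_expPencil_update (δ : Fin 6 → ℝ) (S : Fin 6 → Matrix (Fin 2) (Fin 2) ℝ) (i : Fin 6) (t : ℝ) :
    Continuous fun η : ℝ => (∑ l, Real.exp (δ l * t) • Function.update S i (S i + η • (1 : Matrix (Fin 2) (Fin 2) ℝ)) l).det := by
  simp_rw [det_expPencil_update_eq]
  fun_prop

/-! ## §2 Leading terms at `t → +∞` and `t → −∞` -/

/-- **Top asymptotics (log time).**  With strictly increasing exponents, `det P(t) · e^{−2δ₅ t} → det S₅` as `t → +∞`. [folklore] -/
theorem tendsto_det_expPencil_top (δ : Fin 6 → ℝ) (hd : StrictMono δ) (S : Fin 6 → Matrix (Fin 2) (Fin 2) ℝ) :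
    Tendsto (fun t : ℝ => (∑ l, Real.exp (δ l * t) • S l).det * Real.exp (-(2 * δ 5 * t))) atTop (𝓝 ((S 5).det)) := by
  have hexp : ∀ k l : Fin 6, (k, l) ≠ ((5 : Fin 6), (5 : Fin 6)) → δ k + δ l < 2 * δ 5 := by
    intro k l hkl
    have hk : δ k ≤ δ 5 := hd.monotone (Fin.le_last k)
    have hl : δ l ≤ δ 5 := hd.monotone (Fin.le_last l)
    rcases lt_or_eq_of_le hk with hk' | hk'
    · linarith
    · have : k = 5 := hd.injective hk'
      subst this
      rcases lt_or_eq_of_le hl with hl' | hl'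
      · linarith
      · exact (hkl (by rw [hd.injective hl'])).elim
  have hterm : ∀ k l : Fin 6, Tendsto (fun t : ℝ => Real.exp (δ k * t) * Real.exp (δ l * t) * polar (S k) (S l) * Real.exp (-(2 * δ 5 * t)))
      atTop (𝓝 (if (k, l) = ((5 : Fin 6), (5 : Fin 6)) then polar (S k) (S l) else 0)) := by
    intro k l
    have hrw : ∀ t : ℝ, Real.exp (δ k * t) * Real.exp (δ l * t) * polar (S k) (S l) * Real.exp (-(2 * δ 5 * t))
        = polar (S k) (S l) * Real.exp (-((2 * δ 5 - (δ k + δ l)) * t)) := by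
      intro t
      have : Real.exp (δ k * t) * Real.exp (δ l * t) * Real.exp (-(2 * δ 5 * t)) = Real.exp (-((2 * δ 5 - (δ k + δ l)) * t)) := by
        rw [← Real.exp_add, ← Real.exp_add]; congr 1; ring
      rw [← this]; ring
    simp_rw [hrw]
    by_cases hkl : (k, l) = ((5 : Fin 6), (5 : Fin 6))
    · rw [if_pos hkl]
      obtain ⟨hk5, hl5⟩ := Prod.ext_iff.mp hkl
      simp only at hk5 hl5
      subst hk5; subst hl5
      have : (fun t : ℝ => polar (S 5) (S 5) * Real.exp (-((2 * δ 5 - (δ 5 + δ 5)) * t))) = fun _ => polar (S 5) (S 5) := by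
        funext t; rw [show (2 * δ 5 - (δ 5 + δ 5)) * t = 0 by ring, neg_zero, Real.exp_zero, mul_one]
      rw [this]; exact tendsto_const_nhds
    · rw [if_neg hkl]
      have hc : 0 < 2 * δ 5 - (δ k + δ l) := by linarith [hexp k l hkl]
      have h0 : Tendsto (fun t : ℝ => Real.exp (-((2 * δ 5 - (δ k + δ l)) * t))) atTop (𝓝 0) :=
        Real.tendsto_exp_atBot.comp (tendsto_neg_atTop_atBot.comp (tendsto_id.const_mul_atTop hc))
      simpa using h0.const_mul (polar (S k) (S l))
  have hsum := tendsto_finsetSum Finset.univ fun k (_ : k ∈ Finset.univ) =>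
    tendsto_finsetSum Finset.univ fun l (_ : l ∈ Finset.univ) => hterm k l
  have hlim : (∑ k : Fin 6, ∑ l : Fin 6, if (k, l) = ((5 : Fin 6), (5 : Fin 6)) then polar (S k) (S l) else (0 : ℝ)) = (S 5).det := by
    rw [Finset.sum_eq_single (5 : Fin 6), Finset.sum_eq_single (5 : Fin 6)]
    · simp [polar_self]
    · intro l _ hl; rw [if_neg]; exact fun h => hl (Prod.ext_iff.mp h).2
    · simp
    · intro k _ hk
      exact Finset.sum_eq_zero fun l _ => by rw [if_neg]; exact fun h => hk (Prod.ext_iff.mp h).1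
    · simp
  rw [hlim] at hsum
  refine hsum.congr' (Eventually.of_forall fun t => ?_)
  simp only
  rw [det_sum_smul_fin_two, Finset.sum_mul]
  simp_rw [Finset.sum_mul]

/-- **Bottom asymptotics (log time).**  With strictly increasing exponents, `det P(t) · e^{−2δ₀ t} → det S₀` as `t → −∞`. [folklore] -/
theorem tendsto_det_expPencil_bot (δ : Fin 6 → ℝ) (hd : StrictMono δ) (S : Fin 6 → Matrix (Fin 2) (Fin 2) ℝ) :
    Tendsto (fun t : ℝ => (∑ l, Real.exp (δ l * t) • S l).det * Real.exp (-(2 * δ 0 * t))) atBot (𝓝 ((S 0).det)) := by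
  have hexp : ∀ k l : Fin 6, (k, l) ≠ ((0 : Fin 6), (0 : Fin 6)) → 2 * δ 0 < δ k + δ l := by
    intro k l hkl
    have hk : δ 0 ≤ δ k := hd.monotone (Fin.zero_le k)
    have hl : δ 0 ≤ δ l := hd.monotone (Fin.zero_le l)
    rcases lt_or_eq_of_le hk with hk' | hk'
    · linarith
    · have : k = 0 := (hd.injective hk').symm
      subst this
      rcases lt_or_eq_of_le hl with hl' | hl'
      · linarith
      · exact (hkl (by rw [(hd.injective hl').symm])).elim
  have hterm : ∀ k l : Fin 6, Tendsto (fun t : ℝ => Real.exp (δ k * t) * Real.exp (δ l * t) * polar (S k) (S l) * Real.exp (-(2 * δ 0 * t)))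
      atBot (𝓝 (if (k, l) = ((0 : Fin 6), (0 : Fin 6)) then polar (S k) (S l) else 0)) := by
    intro k l
    have hrw : ∀ t : ℝ, Real.exp (δ k * t) * Real.exp (δ l * t) * polar (S k) (S l) * Real.exp (-(2 * δ 0 * t))
        = polar (S k) (S l) * Real.exp ((δ k + δ l - 2 * δ 0) * t) := by
      intro t
      have : Real.exp (δ k * t) * Real.exp (δ l * t) * Real.exp (-(2 * δ 0 * t)) = Real.exp ((δ k + δ l - 2 * δ 0) * t) := by
        rw [← Real.exp_add, ← Real.exp_add]; congr 1; ring
      rw [← this]; ring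
    simp_rw [hrw]
    by_cases hkl : (k, l) = ((0 : Fin 6), (0 : Fin 6))
    · rw [if_pos hkl]
      obtain ⟨hk0, hl0⟩ := Prod.ext_iff.mp hkl
      simp only at hk0 hl0
      subst hk0; subst hl0
      have : (fun t : ℝ => polar (S 0) (S 0) * Real.exp ((δ 0 + δ 0 - 2 * δ 0) * t)) = fun _ => polar (S 0) (S 0) := by
        funext t; rw [show (δ 0 + δ 0 - 2 * δ 0) * t = 0 by ring, Real.exp_zero, mul_one]
      rw [this]; exact tendsto_const_nhds
    · rw [if_neg hkl]
      have hc : 0 < δ k + δ l - 2 * δ 0 := by linarith [hexp k l hkl]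
      have h0 : Tendsto (fun t : ℝ => Real.exp ((δ k + δ l - 2 * δ 0) * t)) atBot (𝓝 0) :=
        Real.tendsto_exp_atBot.comp (tendsto_id.const_mul_atBot hc)
      simpa using h0.const_mul (polar (S k) (S l))
  have hsum := tendsto_finsetSum Finset.univ fun k (_ : k ∈ Finset.univ) =>
    tendsto_finsetSum Finset.univ fun l (_ : l ∈ Finset.univ) => hterm k l
  have hlim : (∑ k : Fin 6, ∑ l : Fin 6, if (k, l) = ((0 : Fin 6), (0 : Fin 6)) then polar (S k) (S l) else (0 : ℝ)) = (S 0).det := by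
    rw [Finset.sum_eq_single (0 : Fin 6), Finset.sum_eq_single (0 : Fin 6)]
    · simp [polar_self]
    · intro l _ hl; rw [if_neg]; exact fun h => hl (Prod.ext_iff.mp h).2
    · simp
    · intro k _ hk
      exact Finset.sum_eq_zero fun l _ => by rw [if_neg]; exact fun h => hk (Prod.ext_iff.mp h).1
    · simp
  rw [hlim] at hsum
  refine hsum.congr' (Eventually.of_forall fun t => ?_)
  simp only
  rw [det_sum_smul_fin_two, Finset.sum_mul]
  simp_rw [Finset.sum_mul]

end Summit.ValiantsHypothesis.ValiantsHypothesis.Theorems.LacunarySymmetroidMatrixDescartes.WallBubbling
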